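import Literature.Geometry.Lorentzian.KerrRedShiftEstimate
import Literature.Geometry.Lorentzian.KerrRedShiftTimelikePoly
import HarnessLib

/-!
# Explicit constants for the red-shift estimate near extremality: the cut-off derivative and the
# components of `N`
(namespace `Literature.Geometry.Lorentzian.Kerr`.)

The red-shift estimate `Kerr.redShift_estimate` (`KerrRedShiftEstimate.lean`, DRSR Prop. 4.5.2) chooses,
after fixing `a`, four constants by compactness whose size governs its final constant: the coercivity
`b₁` and the collars (made `κ`-explicit in `KerrRedShiftCoercivityPoly.lean`, `KerrRedShiftTimelikePoly.lean`),
and three sup-bounds — `L` for `|∂_μχ|` of the radial cut-off (`Kerr.exists_abs_fderiv_collarCutoff_le`),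
`Ξ` for the components of `N` (`Kerr.exists_abs_redShiftVector_le`) and `D` for `|∂_μg^{αβ}|` of the
surgered background (`Kerr.exists_bound_fderiv_surgeryBackground_inverseMetric`). This file makes the three
sup-bounds explicit and uniform on `|a| ≤ M`:

* `Kerr.abs_dRadius_le_two` — `|∂_μr| ≤ 2` wherever `a² ≤ r²`;
* `Kerr.abs_fderiv_collarCutoff_le` — `|∂_μχ| ≤ 2C_σ/(R₂ − R₁)` (`C_σ` any bound for `|σ'|`,
  `σ = Real.smoothTransition`; `a² ≤ R₁²`): the cut-off error of the red-shift estimate is `∝ 1/width`;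
* `Kerr.abs_redShiftVector_le_four` — `|N^μ| ≤ 4` on the collar `r₊ ≤ r ≤ r₊ + M/16384` for equal
  parameters `h₁ = f₁ = h ≥ 0` with `h(r − r₊) ≤ 1`;
(the third sup-bound is already uniform in the tree: `Kerr.abs_fderiv_surgeryBackground_rPlus_le`,
`|∂_μg^{αβ}| ≤ (4640 + 80C_σ)/M` for `|a| < M`, `KerrEnergyFromLocalEnergy.lean`).

## References
* M. Dafermos, I. Rodnianski, Y. Shlapentokh-Rothman, arXiv:1402.7034, Prop. 4.5.2, §13.2
  (key `DafermosRodnianskiShlapentokhrothman2014`).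
-/

noncomputable section

open Set Filter Metric
open scoped Topology

namespace Literature.Geometry.Lorentzian.Kerr

variable {M a : ℝ} {x : E4}

/-! ### The differential of the radius and of the radial cut-off -/

/-- **`|∂_μ r| ≤ 2` wherever `a² ≤ r²`** (`∂₀r = 0`, `∂ᵢr = rxᵢ/Σ` (`i = 1, 2`), `∂₃r = (r² + a²)x₃/(rΣ)`,
`Σ ≥ r²`, `xᵢ² ≤ r² + a² ≤ 2r²`, `x₃² ≤ r²`). [cite: arXiv07060622, (35)] -/
theorem abs_dRadius_le_two (hx : 0 < radius a x) (har : a ^ 2 ≤ radius a x ^ 2) (μ : Fin 4) :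
    |dRadius a x μ| ≤ 2 := by
  have hS := blSigma_spatial_pos hx
  have hRS : radius a x ^ 2 ≤ blSigma a (E4.spatial x) := sq_le_blSigma_spatial hx
  have h12 : x 1 ^ 2 + x 2 ^ 2 ≤ radius a x ^ 2 + a ^ 2 := sq_add_sq_le_radius_sq_add hx
  have h3 : x 3 ^ 2 ≤ radius a x ^ 2 := sq_apply_three_le_radius_sq a hx
  set r := radius a x with hr
  set S := blSigma a (E4.spatial x) with hS_def
  have key : ∀ {t : ℝ}, t ^ 2 ≤ 4 → |t| ≤ 2 := fun {t} ht ↦ by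
    rw [← Real.sqrt_sq_eq_abs, show (2 : ℝ) = √4 by rw [show (4:ℝ) = 2 ^ 2 by norm_num, Real.sqrt_sq two_pos.le]]
    exact Real.sqrt_le_sqrt ht
  fin_cases μ
  · simp only [dRadius_apply, Fin.zero_eta, Fin.isValue, fderiv_radius_basisVector_zero a hx, abs_zero]
    norm_num
  · simp only [dRadius_apply, Fin.mk_one, Fin.isValue, fderiv_radius_basisVector_one hx, ← hr, ← hS_def]
    apply key
    rw [div_pow, div_le_iff₀ (by positivity)]
    nlinarith [mul_le_mul hRS hRS (by positivity) hS.le, sq_nonneg (x 2), sq_nonneg (r * x 1)]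
  · simp only [dRadius_apply, Fin.reduceFinMk, Fin.isValue, fderiv_radius_basisVector_two hx, ← hr, ← hS_def]
    apply key
    rw [div_pow, div_le_iff₀ (by positivity)]
    nlinarith [mul_le_mul hRS hRS (by positivity) hS.le, sq_nonneg (x 1), sq_nonneg (r * x 2)]
  · simp only [dRadius_apply, Fin.reduceFinMk, Fin.isValue, fderiv_radius_basisVector_three hx, ← hr, ← hS_def]
    apply key
    rw [div_pow, div_le_iff₀ (by positivity)]
    have h4 : (r ^ 2 * x 3 + a ^ 2 * x 3) ^ 2 = (r ^ 2 + a ^ 2) ^ 2 * x 3 ^ 2 := by ring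
    rw [h4]
    have h5 : (r ^ 2 + a ^ 2) ^ 2 ≤ (2 * r ^ 2) ^ 2 :=
      pow_le_pow_left₀ (by positivity) (by linarith) 2
    have h6 : (r ^ 2 + a ^ 2) ^ 2 * x 3 ^ 2 ≤ (2 * r ^ 2) ^ 2 * r ^ 2 :=
      mul_le_mul h5 h3 (sq_nonneg _) (by positivity)
    nlinarith [mul_le_mul hRS hRS (by positivity) hS.le, h6, sq_nonneg r]

/-- **The differential of the radial cut-off is `O(1/width)`, explicitly**: if `|σ'| ≤ C_σ`
(`σ = Real.smoothTransition`), `0 < R₁ < R₂` and `a² ≤ R₁²`, then `|∂_μ χ(x)| ≤ 2C_σ/(R₂ − R₁)` at every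
`x ∈ ℝ⁴`, `χ = Kerr.collarCutoff a R₁ R₂` (chain rule in the shell `R₁ ≤ r ≤ R₂`, where `|∂_μr| ≤ 2`;
`∂χ = 0` off the shell, `Kerr.fderiv_collarCutoff_eq_zero`). [cite: DafermosRodnianskiShlapentokhrothman2014, §13.2] -/
theorem abs_fderiv_collarCutoff_le {Cσ R₁ R₂ : ℝ} (hCσ : ∀ t, |deriv Real.smoothTransition t| ≤ Cσ)
    (hR₁ : 0 < R₁) (hR : R₁ < R₂) (haR : a ^ 2 ≤ R₁ ^ 2) (x : E4) (μ : Fin 4) :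
    |fderiv ℝ (collarCutoff a R₁ R₂) x (E4.basisVector μ)| ≤ 2 * Cσ / (R₂ - R₁) := by
  have hC0 : 0 ≤ Cσ := (abs_nonneg _).trans (hCσ 0)
  have hw : 0 < R₂ - R₁ := sub_pos.2 hR
  by_cases hout : radius a x < R₁ ∨ R₂ < radius a x
  · rw [fderiv_collarCutoff_eq_zero hR hout]
    rw [zero_apply, abs_zero]
    positivity
  rw [not_or, not_lt, not_lt] at hout
  have hx : 0 < radius a x := hR₁.trans_le hout.1
  have har : a ^ 2 ≤ radius a x ^ 2 := haR.trans (pow_le_pow_left₀ hR₁.le hout.1 2)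
  -- chain rule
  have hrad : HasFDerivAt (radius a) (fderiv ℝ (radius a) x) x :=
    ((contDiffAt_radius hx (n := 1)).differentiableAt one_ne_zero).hasFDerivAt
  have hg : HasFDerivAt (fun y ↦ (R₂ - R₁)⁻¹ * (R₂ - radius a y))
      ((R₂ - R₁)⁻¹ • (-fderiv ℝ (radius a) x)) x := by
    have h := ((hasFDerivAt_const R₂ x).sub hrad).const_mul (R₂ - R₁)⁻¹
    simpa using h
  have hσ : HasDerivAt Real.smoothTransition
      (deriv Real.smoothTransition ((R₂ - R₁)⁻¹ * (R₂ - radius a x))) ((R₂ - R₁)⁻¹ * (R₂ - radius a x)) :=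
    ((Real.smoothTransition.contDiff (n := 1)).differentiable one_ne_zero).differentiableAt.hasDerivAt
  have hcomp := hσ.comp_hasFDerivAt x hg
  have hfun : collarCutoff a R₁ R₂ = Real.smoothTransition ∘ fun y ↦ (R₂ - R₁)⁻¹ * (R₂ - radius a y) := by
    funext y
    simp only [collarCutoff, Function.comp_apply, div_eq_inv_mul]
  rw [hfun, hcomp.fderiv]
  simp only [smul_apply, neg_apply, smul_eq_mul, mul_neg, abs_neg, abs_mul, abs_inv, abs_of_pos hw]
  have hdr : |fderiv ℝ (radius a) x (E4.basisVector μ)| ≤ 2 := abs_dRadius_le_two hx har μ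
  calc |deriv Real.smoothTransition ((R₂ - R₁)⁻¹ * (R₂ - radius a x))| *
        ((R₂ - R₁)⁻¹ * |fderiv ℝ (radius a) x (E4.basisVector μ)|)
      ≤ Cσ * ((R₂ - R₁)⁻¹ * 2) :=
        mul_le_mul (hCσ _) (mul_le_mul_of_nonneg_left hdr (by positivity)) (by positivity) hC0
    _ = 2 * Cσ / (R₂ - R₁) := by field_simp

/-! ### The components of `N` on the collar -/

/-- **`|N^μ| ≤ 4` on the collar** `r₊ ≤ r ≤ r₊ + M/16384` for equal parameters `h₁ = f₁ = h ≥ 0` with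
`h(r − r₊) ≤ 1` (`|a| ≤ M`): `N^μ = (1 + hs)(K^μ − ℓ^μ)` with `1 + hs ≤ 2`, `|K^μ| ≤ 1`
(`|ω₊xᵢ| ≤ |ω₊|‖Φ⃗‖ ≤ ¾`), `|ℓ^μ| ≤ 1`. [cite: DafermosRodnianskiShlapentokhrothman2014, Prop. 4.5.1] -/
theorem abs_redShiftVector_le_four (hMa : |a| ≤ M) (hM : 0 < M) {h : ℝ} (hh : 0 ≤ h)
    (hr₁ : rPlus M a ≤ radius a x) (hr₂ : radius a x ≤ rPlus M a + M / 16384)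
    (hhs : h * (radius a x - rPlus M a) ≤ 1) (μ : Fin 4) : |redShiftVector M a h h x μ| ≤ 4 := by
  have hrp0 : 0 < rPlus M a := rPlus_pos hM a
  have hx : 0 < radius a x := hrp0.trans_le hr₁
  have hc0 : 0 ≤ 1 + h * (radius a x - rPlus M a) := by nlinarith
  have hc1 : 1 + h * (radius a x - rPlus M a) ≤ 2 := by linarith
  have hω := abs_horizonAngularVelocity_mul_spatialNorm_le hMa hM hr₁ hr₂
  have hΦn : ∀ ν, |axialVector x ν| ≤ E4.spatialNorm (axialVector x) := by
    intro ν
    have hsq := spatialNorm_axialVector_sq x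
    have h0 := E4.spatialNorm_nonneg (axialVector x)
    have hν : axialVector x ν ^ 2 ≤ E4.spatialNorm (axialVector x) ^ 2 := by
      rw [hsq]
      fin_cases ν <;> simp [axialVector_apply_zero, axialVector_apply_one, axialVector_apply_two,
        axialVector_apply_three] <;> nlinarith [sq_nonneg (x 1), sq_nonneg (x 2)]
    exact abs_le_of_sq_le_sq' hν h0 |> fun h ↦ abs_le.2 h
  have hK : |hawkingVector M a x μ| ≤ 1 := by
    have hΦμ : |horizonAngularVelocity M a * axialVector x μ| ≤ 3 / 4 := by
      rw [abs_mul]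
      exact (mul_le_mul_of_nonneg_left (hΦn μ) (abs_nonneg _)).trans hω
    rw [hawkingVector_apply]
    have e0 : ∀ ν : Fin 4, E4.basisVector (0 : Fin 4) ν = if ν = 0 then 1 else 0 := fun ν ↦ by
      fin_cases ν <;> simp [E4.basisVector]
    rw [e0]
    by_cases hμ : μ = 0
    · subst hμ
      rw [if_pos rfl, axialVector_apply_zero, mul_zero, add_zero, abs_one]
    · rw [if_neg hμ, zero_add]
      linarith
  have hℓ : |nullVector a x μ| ≤ 1 := abs_nullVector_le_one hx μ
  rw [redShiftVector]
  calc |(1 + h * (radius a x - rPlus M a)) * hawkingVector M a x μ +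
        -(1 + h * (radius a x - rPlus M a)) * nullVector a x μ|
      ≤ |(1 + h * (radius a x - rPlus M a)) * hawkingVector M a x μ| +
        |-(1 + h * (radius a x - rPlus M a)) * nullVector a x μ| := abs_add_le _ _
    _ = (1 + h * (radius a x - rPlus M a)) * (|hawkingVector M a x μ| + |nullVector a x μ|) := by
        rw [abs_mul, abs_mul, abs_neg, abs_of_nonneg hc0]; ring
    _ ≤ 2 * (1 + 1) := mul_le_mul hc1 (add_le_add hK hℓ) (by positivity) zero_le_two
    _ = 4 := by norm_num

end Literature.Geometry.Lorentzian.Kerr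

end
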